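import Literature.NumberTheory.LFunctions.GranvilleSoundararajanLemma21
import Literature.NumberTheory.LFunctions.HalaszIntegration
import HarnessLib

/-!
# Granville–Soundararajan 2003, Lemma 2.1 (2.2) and the kernel step of Proposition 3.3

Ingredients of the proof of **Theorem 4** of A. Granville, K. Soundararajan, *Decay of mean values
of multiplicative functions*, Canad. J. Math. 55 (2003) (the twisted Lipschitz estimate), which
rests on Proposition 3.3, the Lipschitz variant of Proposition 1.  For a multiplicative `1`-bounded
`f : ℕ → ℂ`, `S(z) = ∑_{n ≤ z} f(n)` (`Halasz.S`) and a real `w ≥ 1`, this file proves, in the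
logarithmic scale `u = log y` of the tree's Lemma 2.1 files:

* `exists_norm_S_sub_mul_log_le_integral` — **Lemma 2.1, (2.2)**: for `x ≥ 3w`,
  `‖S(x) - wS(x/w)‖/x · log x ≤ ∫_{log 2w}^{log x} |S(e^u) - wS(e^u/w)| e^{-u} du + C log 2w`, i.e.
  `|S(x)/x - S(x/w)/(x/w)| ≤ (1/log x)∫_{2w}^{x} |S(y)/y - S(y/w)/(y/w)| dy/y + O(log 2w/log x)`.
  Proof as printed: (2.3) at `x` and at `x/w` (`GranvilleSoundararajanLemma21.norm_sum_mul_log_sub_le`)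
  gives `‖S(x) - wS(x/w)‖ log x ≤ ∑_{d ≤ x} Λ(d) ‖S(x/d) - wS(x/(wd))‖ + O(x log 2w)`; then the partial
  summation against `ψ(d) = d + O(d/log² d)` of the proof of (2.1) (`HalaszPartialSummation`) is
  repeated for the differences `a_d = ‖S(x/d) - wS(x/(wd))‖`, whose variation is controlled by
  `k_d(x) + w k_d(x/w)`, and the sum `∑_d a_d` is compared with the integral.
* `integral_normD_le` — the **kernel step** of the proof of Proposition 3.3 ("Arguing as in (3.7)"):
  `∫_{log 2w}^{log x} |S(e^u) - wS(e^u/w)| e^{-u} du ≤ 17 ∫_{α₀}^{1} ∫_{log 2w}^{log x} |A(e^u) - wA(e^u/w)| e^{-(1+2α)u} du dα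
   + 3 log(2w) log(log x/log 2w)` with `A(y) = ∑_{n ≤ y} f̃(n) log n`, `α₀ = 1/(2 log x)` (one-sided, crude
  constant `17`, as in the tree's `Halasz.integral_normSExp_le`); the term `log 2w · log(log x/log 2w)`
  is the one displayed in Proposition 3.3.
* `norm_twisted_kernel_le`, `integrable_twisted_kernel` — boundedness/integrability of the kernel
  `|A(e^u) - wA(e^u/w)| e^{-(1+2α)u}` on the rectangle (Fubini).

## References
- [GranvilleSoundararajan2003] A. Granville, K. Soundararajan, *Decay of mean values of
  multiplicative functions*, Canad. J. Math. 55 (2003), 1191–1230: Lemma 2.1 with its proof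
  ((2.2)–(2.4)), §3b (3.7) and the proof of Proposition 3.3; arXiv math/9911246 pp. 4–5, 7–8.

## Design choices
* `f : ℕ → ℂ` coprime-multiplicative and `1`-bounded, as in `GranvilleSoundararajanLemma21`; the
  difference is kept un-normalised, `‖S(x) - w S(x/w)‖`, and the integrand is
  `‖S(e^u) - w S(e^u/w)‖ e^{-u}`; no definitions are introduced.
* (2.2) is stated for `3w ≤ x` (so that `x/w ≥ 3` for the prime number theorem input); the printed
  range `1 ≤ w ≤ x` is recovered trivially downstream (for `w > x/3` the left side is `≤ 2 ≪ log 2w/log x · log x`).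
* Constants are absolute and existential.
-/

noncomputable section

open Finset Real Complex MeasureTheory
open scoped ArithmeticFunction.vonMangoldt

namespace Literature.NumberTheory.LFunctions

namespace GranvilleSoundararajan

open Halasz (S normSExp kk smoothCut mulLog)
open MellinPlancherel (psum)

variable {f : ℕ → ℂ}

/-! ### (2.3) twice: the decomposition of `(S(x) - w S(x/w)) log x` -/

/-- `S(y) log y = ∑_{n ≤ y} f(n) log n + ∑_{n ≤ y} f(n) log(y/n)` (`y > 0`). [folklore] -/
theorem S_mul_log_eq (f : ℕ → ℂ) {y : ℝ} (hy : 0 < y) :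
    S f y * (Real.log y : ℂ) = ∑ n ∈ Icc 1 ⌊y⌋₊, f n * (Real.log n : ℂ) +
      ∑ n ∈ Icc 1 ⌊y⌋₊, f n * (Real.log (y / n) : ℂ) := by
  unfold S
  rw [Finset.sum_mul, ← Finset.sum_add_distrib]
  refine Finset.sum_congr rfl fun n hn => ?_
  rw [Finset.mem_Icc] at hn
  have hn0 : (0 : ℝ) < n := by exact_mod_cast hn.1
  rw [← mul_add, ← Complex.ofReal_add, Real.log_div hy.ne' hn0.ne']
  ring_nf

/-- `‖∑_{n ≤ y} f(n) log(y/n)‖ ≤ y` for `|f| ≤ 1`, `y ≥ 1`. [folklore] -/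
theorem norm_sum_mul_log_div_le (hfb : ∀ n, ‖f n‖ ≤ 1) {y : ℝ} (hy : 1 ≤ y) :
    ‖∑ n ∈ Icc 1 ⌊y⌋₊, f n * (Real.log (y / n) : ℂ)‖ ≤ y := by
  have hy0 : 0 < y := by linarith
  refine (norm_sum_le _ _).trans ?_
  refine le_trans (Finset.sum_le_sum fun n hn => ?_) (Halasz.sum_log_div_le hy)
  rw [Finset.mem_Icc] at hn
  have hn0 : (0 : ℝ) < n := by exact_mod_cast hn.1
  have hlog : 0 ≤ Real.log (y / n) := Real.log_nonneg (by
    rw [le_div_iff₀ hn0, one_mul]; exact le_trans (by exact_mod_cast hn.2) (Nat.floor_le hy0.le))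
  rw [norm_mul, Complex.norm_real, Real.norm_of_nonneg hlog]
  exact mul_le_of_le_one_left hlog (hfb n)

/-- `‖∑_{n ≤ y} f(n) log(y/n)‖ ≤ y` also for `0 ≤ y < 1` (the sum is empty), hence for all `y ≥ 0`.
[folklore] -/
theorem norm_sum_mul_log_div_le' (hfb : ∀ n, ‖f n‖ ≤ 1) {y : ℝ} (hy : 0 ≤ y) :
    ‖∑ n ∈ Icc 1 ⌊y⌋₊, f n * (Real.log (y / n) : ℂ)‖ ≤ y := by
  rcases le_or_gt 1 y with h | h
  · exact norm_sum_mul_log_div_le hfb h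
  · rw [Nat.floor_eq_zero.mpr h]
    simp [hy]

/-- **(2.3) with remainder**: there is an absolute `C₁` such that for multiplicative `1`-bounded `f`
and `y ≥ 0`, `‖S(y) log y − ∑_{d ≤ y} Λ(d) f(d) S(y/d)‖ ≤ C₁ y`.
[cite: GranvilleSoundararajan2003, Lemma 2.1, (2.3)] -/
theorem exists_norm_S_mul_log_sub_sum_le :
    ∃ C₁ : ℝ, 0 ≤ C₁ ∧ ∀ f : ℕ → ℂ, (∀ m n, Nat.Coprime m n → f (m * n) = f m * f n) →
      (∀ n, ‖f n‖ ≤ 1) → ∀ y : ℝ, 0 ≤ y →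
        ‖S f y * (Real.log y : ℂ) - ∑ d ∈ Icc 1 ⌊y⌋₊, (Λ d : ℂ) * f d * S f (y / d)‖ ≤ C₁ * y := by
  obtain ⟨C₀, hC₀, hE⟩ := exists_sum_vonMangoldt_div_mul_minFac_le
  refine ⟨1 + 2 * C₀, by positivity, fun f hf hfb y hy => ?_⟩
  rcases hy.eq_or_lt with rfl | hy0
  · simp [S]
  rw [S_mul_log_eq f hy0]
  have h23 := norm_sum_mul_log_sub_le hf hfb hy
  have hR := norm_sum_mul_log_div_le' hfb hy
  have herr : 2 * y * ∑ d ∈ Icc 1 ⌊y⌋₊, Λ d / ((d : ℝ) * d.minFac) ≤ 2 * C₀ * y := by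
    calc 2 * y * ∑ d ∈ Icc 1 ⌊y⌋₊, Λ d / ((d : ℝ) * d.minFac) ≤ 2 * y * C₀ := by gcongr; exact hE _
      _ = 2 * C₀ * y := by ring
  calc ‖∑ n ∈ Icc 1 ⌊y⌋₊, f n * (Real.log n : ℂ) + ∑ n ∈ Icc 1 ⌊y⌋₊, f n * (Real.log (y / n) : ℂ) -
        ∑ d ∈ Icc 1 ⌊y⌋₊, (Λ d : ℂ) * f d * S f (y / d)‖
      = ‖(∑ n ∈ Icc 1 ⌊y⌋₊, f n * (Real.log n : ℂ) - ∑ d ∈ Icc 1 ⌊y⌋₊, (Λ d : ℂ) * f d * S f (y / d)) +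
          ∑ n ∈ Icc 1 ⌊y⌋₊, f n * (Real.log (y / n) : ℂ)‖ := by ring_nf
    _ ≤ ‖∑ n ∈ Icc 1 ⌊y⌋₊, f n * (Real.log n : ℂ) - ∑ d ∈ Icc 1 ⌊y⌋₊, (Λ d : ℂ) * f d * S f (y / d)‖ +
          ‖∑ n ∈ Icc 1 ⌊y⌋₊, f n * (Real.log (y / n) : ℂ)‖ := norm_add_le _ _
    _ ≤ 2 * C₀ * y + y := add_le_add (h23.trans herr) hR
    _ = (1 + 2 * C₀) * y := by ring

/-- Extending the `d`-sum: for `0 ≤ z ≤ x`, `∑_{d ≤ z} Λ(d) f(d) S(z/d) = ∑_{d ≤ x} Λ(d) f(d) S(z/d)`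
(the added terms vanish since `z/d < 1`). [folklore] -/
theorem sum_vonMangoldt_mul_S_eq_sum (f : ℕ → ℂ) {z x : ℝ} (hz : 0 ≤ z) (hzx : z ≤ x) :
    ∑ d ∈ Icc 1 ⌊z⌋₊, (Λ d : ℂ) * f d * S f (z / d) = ∑ d ∈ Icc 1 ⌊x⌋₊, (Λ d : ℂ) * f d * S f (z / d) := by
  refine Finset.sum_subset (fun d hd => ?_) (fun d hd hdz => ?_)
  · rw [Finset.mem_Icc] at hd ⊢
    exact ⟨hd.1, hd.2.trans (Nat.floor_le_floor hzx)⟩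
  · rw [Finset.mem_Icc] at hd hdz
    push Not at hdz
    have hd' : ⌊z⌋₊ < d := by
      by_contra h; push Not at h; exact absurd (hdz hd.1) (not_lt.mpr h)
    have hlt : z / d < 1 := by
      have hd0 : (0 : ℝ) < d := by exact_mod_cast hd.1
      rw [div_lt_one hd0]
      exact (Nat.floor_lt hz).mp hd'
    rw [Halasz.S_of_lt_one f hlt, mul_zero]

/-- **(2.2), first step** (GS03 §2, display after "To show (2.2)"): there is an absolute `C₂` such
that for multiplicative `1`-bounded `f`, `1 ≤ w`, `0 < x`:
`‖S(x) − w S(x/w)‖ log x ≤ ∑_{d ≤ x} Λ(d) ‖S(x/d) − w S((x/w)/d)‖ + x (C₂ + log w)`.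
[cite: GranvilleSoundararajan2003, proof of Lemma 2.1, (2.2)] -/
theorem exists_norm_S_sub_mul_log_le_sum :
    ∃ C₂ : ℝ, 0 ≤ C₂ ∧ ∀ f : ℕ → ℂ, (∀ m n, Nat.Coprime m n → f (m * n) = f m * f n) →
      (∀ n, ‖f n‖ ≤ 1) → ∀ x w : ℝ, 1 ≤ w → 0 < x →
        ‖S f x - (w : ℂ) * S f (x / w)‖ * Real.log x ≤
          ∑ d ∈ Icc 1 ⌊x⌋₊, Λ d * ‖S f (x / d) - (w : ℂ) * S f (x / w / d)‖ + x * (C₂ + Real.log w) := by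
  obtain ⟨C₁, hC₁, h23⟩ := exists_norm_S_mul_log_sub_sum_le
  refine ⟨2 * C₁, by positivity, fun f hf hfb x w hw hx => ?_⟩
  have hw0 : 0 < w := by linarith
  have hxw : 0 ≤ x / w := by positivity
  have hxwx : x / w ≤ x := div_le_self hx.le hw
  set M : ℝ → ℂ := fun z => ∑ d ∈ Icc 1 ⌊x⌋₊, (Λ d : ℂ) * f d * S f (z / d) with hM
  have hx' := h23 f hf hfb x hx.le
  have hxw' := h23 f hf hfb (x / w) hxw
  rw [sum_vonMangoldt_mul_S_eq_sum f hxw hxwx] at hxw'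
  -- the identity
  have hlogw : (Real.log x : ℂ) = (Real.log (x / w) : ℂ) + (Real.log w : ℂ) := by
    rw [← Complex.ofReal_add, Real.log_div hx.ne' hw0.ne']; ring_nf
  have hid : (S f x - (w : ℂ) * S f (x / w)) * (Real.log x : ℂ) =
      (S f x * (Real.log x : ℂ) - M x) - (w : ℂ) * (S f (x / w) * (Real.log (x / w) : ℂ) - M (x / w)) +
        (M x - (w : ℂ) * M (x / w)) - (w : ℂ) * S f (x / w) * (Real.log w : ℂ) := by
    rw [hlogw]; ring
  have hdiff : M x - (w : ℂ) * M (x / w) =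
      ∑ d ∈ Icc 1 ⌊x⌋₊, (Λ d : ℂ) * f d * (S f (x / d) - (w : ℂ) * S f (x / w / d)) := by
    simp only [hM]
    rw [Finset.mul_sum, ← Finset.sum_sub_distrib]
    refine Finset.sum_congr rfl fun d _ => ?_
    ring
  have hnorm : ‖S f x - (w : ℂ) * S f (x / w)‖ * Real.log x =
      ‖(S f x - (w : ℂ) * S f (x / w)) * (Real.log x : ℂ)‖ := by
    rcases le_or_gt 1 x with h1 | h1
    · rw [norm_mul, Complex.norm_real, Real.norm_of_nonneg (Real.log_nonneg h1)]
    · -- `x < 1`: both `S` vanish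
      have h0 : S f x = 0 := Halasz.S_of_lt_one f h1
      have h0' : S f (x / w) = 0 := Halasz.S_of_lt_one f (hxwx.trans_lt h1)
      simp [h0, h0']
  rw [hnorm, hid]
  have hmain : ‖M x - (w : ℂ) * M (x / w)‖ ≤
      ∑ d ∈ Icc 1 ⌊x⌋₊, Λ d * ‖S f (x / d) - (w : ℂ) * S f (x / w / d)‖ := by
    rw [hdiff]
    refine (norm_sum_le _ _).trans (Finset.sum_le_sum fun d _ => ?_)
    rw [norm_mul, norm_mul, Complex.norm_real, Real.norm_of_nonneg ArithmeticFunction.vonMangoldt_nonneg]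
    calc Λ d * ‖f d‖ * ‖S f (x / d) - (w : ℂ) * S f (x / w / d)‖
        ≤ Λ d * 1 * ‖S f (x / d) - (w : ℂ) * S f (x / w / d)‖ :=
          mul_le_mul_of_nonneg_right (mul_le_mul_of_nonneg_left (hfb d) ArithmeticFunction.vonMangoldt_nonneg)
            (norm_nonneg _)
      _ = Λ d * ‖S f (x / d) - (w : ℂ) * S f (x / w / d)‖ := by ring
  have hlast : ‖(w : ℂ) * S f (x / w) * (Real.log w : ℂ)‖ ≤ x * Real.log w := by
    rw [norm_mul, norm_mul, Complex.norm_real, Complex.norm_real, Real.norm_of_nonneg hw0.le,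
      Real.norm_of_nonneg (Real.log_nonneg hw)]
    have hS := Halasz.norm_S_le' hfb hxw
    have hlw : 0 ≤ Real.log w := Real.log_nonneg hw
    calc w * ‖S f (x / w)‖ * Real.log w ≤ w * (x / w) * Real.log w := by gcongr
      _ = x * Real.log w := by field_simp
  have hsec : ‖(w : ℂ) * (S f (x / w) * (Real.log (x / w) : ℂ) - M (x / w))‖ ≤ C₁ * x := by
    rw [norm_mul, Complex.norm_real, Real.norm_of_nonneg hw0.le]
    calc w * ‖S f (x / w) * (Real.log (x / w) : ℂ) - M (x / w)‖ ≤ w * (C₁ * (x / w)) := by gcongr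
      _ = C₁ * x := by field_simp
  calc ‖(S f x * (Real.log x : ℂ) - M x) - (w : ℂ) * (S f (x / w) * (Real.log (x / w) : ℂ) - M (x / w)) +
        (M x - (w : ℂ) * M (x / w)) - (w : ℂ) * S f (x / w) * (Real.log w : ℂ)‖
      ≤ ‖(S f x * (Real.log x : ℂ) - M x)‖ + ‖(w : ℂ) * (S f (x / w) * (Real.log (x / w) : ℂ) - M (x / w))‖ +
        ‖M x - (w : ℂ) * M (x / w)‖ + ‖(w : ℂ) * S f (x / w) * (Real.log w : ℂ)‖ := by
        refine (norm_sub_le _ _).trans (add_le_add ((norm_add_le _ _).trans (add_le_add (norm_sub_le _ _) le_rfl)) le_rfl)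
    _ ≤ C₁ * x + C₁ * x + ∑ d ∈ Icc 1 ⌊x⌋₊, Λ d * ‖S f (x / d) - (w : ℂ) * S f (x / w / d)‖ + x * Real.log w :=
        add_le_add (add_le_add (add_le_add hx' hsec) hmain) hlast
    _ = ∑ d ∈ Icc 1 ⌊x⌋₊, Λ d * ‖S f (x / d) - (w : ℂ) * S f (x / w / d)‖ + x * (2 * C₁ + Real.log w) := by ring

/-! ### Abel summation against the prime number theorem for the differences -/

/-- **Abel summation against `ψ(d) = d + O(d/log² d)`**, abstract form: if `a_{Y+1} = 0` and
`|a_d - a_{d+1}| ≤ k_d` (`1 ≤ d ≤ Y`), then `∑_{d ≤ Y} Λ(d) a_d ≤ ∑_{d ≤ Y} a_d + ∑_{d ≤ Y} |ψ(d) - d| k_d`.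
[cite: GranvilleSoundararajan2003, proof of Lemma 2.1 ("We now mimic the partial summation argument")] -/
theorem sum_vonMangoldt_mul_le_of_abs_sub_le {a k : ℕ → ℝ} (Y : ℕ) (haY : a (Y + 1) = 0)
    (hk : ∀ d ∈ Icc 1 Y, |a d - a (d + 1)| ≤ k d) :
    ∑ d ∈ Icc 1 Y, Λ d * a d ≤ ∑ d ∈ Icc 1 Y, a d + ∑ d ∈ Icc 1 Y, |Chebyshev.psi d - d| * k d := by
  have h1 := Halasz.abel_sum (fun d : ℕ => Chebyshev.psi d) a Y
  have h2 := Halasz.abel_sum (fun d : ℕ => (d : ℝ)) a Y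
  simp only [Nat.cast_zero, Chebyshev.psi_zero, zero_mul, sub_zero, haY, mul_zero, add_zero] at h1 h2
  have h1' : ∑ d ∈ Icc 1 Y, Λ d * a d = ∑ d ∈ Icc 1 Y, Chebyshev.psi d * (a d - a (d + 1)) := by
    rw [← h1]
    refine Finset.sum_congr rfl fun d hd => ?_
    rw [Finset.mem_Icc] at hd
    rw [Halasz.psi_sub_psi_pred hd.1]
  have h2' : ∑ d ∈ Icc 1 Y, a d = ∑ d ∈ Icc 1 Y, (d : ℝ) * (a d - a (d + 1)) := by
    rw [← h2]
    refine Finset.sum_congr rfl fun d hd => ?_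
    rw [Finset.mem_Icc] at hd
    rw [Nat.cast_sub hd.1]; push_cast; ring
  rw [h1', h2', ← Finset.sum_add_distrib]
  refine Finset.sum_le_sum fun d hd => ?_
  have hkd := hk d hd
  have : (Chebyshev.psi d - d) * (a d - a (d + 1)) ≤ |Chebyshev.psi d - d| * k d := by
    calc (Chebyshev.psi d - d) * (a d - a (d + 1)) ≤ |(Chebyshev.psi d - d) * (a d - a (d + 1))| := le_abs_self _
      _ = |Chebyshev.psi d - d| * |a d - a (d + 1)| := abs_mul _ _
      _ ≤ |Chebyshev.psi d - d| * k d := by gcongr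
  linarith

variable {x w : ℝ}

/-- `kk z d = 0` for `0 ≤ z < d`. [folklore] -/
theorem kk_eq_zero_of_lt {z : ℝ} (hz : 0 ≤ z) {d : ℕ} (hd : z < d) : kk z d = 0 := by
  unfold kk
  have hd0 : (0 : ℝ) < d := hz.trans_lt hd
  have h1 : ⌊z / d⌋₊ = 0 := by
    rw [Nat.floor_eq_zero, div_lt_one hd0]; exact hd
  have h2 : ⌊z / ((d : ℝ) + 1)⌋₊ = 0 := by
    rw [Nat.floor_eq_zero, div_lt_one (by linarith)]; linarith
  rw [h1, h2]; simp

/-- Extending the range of `∑ |ψ(d) - d| k_d(z)` from `d ≤ z` to `d ≤ x` (`0 ≤ z ≤ x`) changes nothing.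
[folklore] -/
theorem sum_abs_psi_sub_mul_kk_eq {z x : ℝ} (hz : 0 ≤ z) (hzx : z ≤ x) :
    ∑ d ∈ Icc 1 ⌊x⌋₊, |Chebyshev.psi d - d| * kk z d = ∑ d ∈ Icc 1 ⌊z⌋₊, |Chebyshev.psi d - d| * kk z d := by
  symm
  refine Finset.sum_subset (fun d hd => ?_) (fun d hd hdz => ?_)
  · rw [Finset.mem_Icc] at hd ⊢
    exact ⟨hd.1, hd.2.trans (Nat.floor_le_floor hzx)⟩
  · rw [Finset.mem_Icc] at hd hdz
    push Not at hdz
    have hd' : ⌊z⌋₊ < d := by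
      by_contra h; push Not at h; exact absurd (hdz hd.1) (not_lt.mpr h)
    rw [kk_eq_zero_of_lt hz ((Nat.floor_lt hz).mp hd'), mul_zero]

/-- The differences `a_d = ‖S(x/d) - w S(x/w/d)‖` vary by at most `k_d(x) + w k_d(x/w)`. [folklore] -/
theorem abs_norm_Sdiff_sub_le (hfb : ∀ n, ‖f n‖ ≤ 1) (hx : 0 ≤ x) (hw : 0 ≤ w) {d : ℕ} (hd : 1 ≤ d) :
    |‖S f (x / d) - (w : ℂ) * S f (x / w / d)‖ - ‖S f (x / (d + 1)) - (w : ℂ) * S f (x / w / (d + 1))‖| ≤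
      kk x d + w * kk (x / w) d := by
  have hxw : 0 ≤ x / w := div_nonneg hx hw
  have h1 := Halasz.norm_S_sub_S_le hfb (Halasz.floor_div_succ_le hx hd) (g := f)
  have h2 := Halasz.norm_S_sub_S_le hfb (Halasz.floor_div_succ_le hxw hd) (g := f)
  have htri := abs_norm_sub_norm_le (S f (x / d) - (w : ℂ) * S f (x / w / d))
    (S f (x / (d + 1)) - (w : ℂ) * S f (x / w / (d + 1)))
  have hdiff : (S f (x / d) - (w : ℂ) * S f (x / w / d)) - (S f (x / (d + 1)) - (w : ℂ) * S f (x / w / (d + 1))) =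
      (S f (x / d) - S f (x / (d + 1))) - (w : ℂ) * (S f (x / w / d) - S f (x / w / (d + 1))) := by ring
  rw [hdiff] at htri
  refine htri.trans ((norm_sub_le _ _).trans ?_)
  rw [norm_mul, Complex.norm_real, Real.norm_of_nonneg hw]
  unfold kk
  gcongr

/-- **The error term for the differences**: for `x/w ≥ 3`, `w ≥ 1`,
`∑_{d ≤ x} |ψ(d) - d| (k_d(x) + w k_d(x/w)) ≤ 2 C_E x`. [cite: GranvilleSoundararajan2003, proof of Lemma 2.1] -/
theorem exists_sum_abs_psi_sub_mul_kk_add_le :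
    ∃ C : ℝ, 0 ≤ C ∧ ∀ x w : ℝ, 1 ≤ w → 3 * w ≤ x →
      ∑ d ∈ Icc 1 ⌊x⌋₊, |Chebyshev.psi d - d| * (kk x d + w * kk (x / w) d) ≤ C * x := by
  obtain ⟨C, hC⟩ := Halasz.exists_sum_abs_psi_sub_mul_kk_le
  have hC0 : 0 ≤ C := by
    have h := hC 3 le_rfl
    have h0 : 0 ≤ ∑ d ∈ Icc 1 ⌊(3:ℝ)⌋₊, |Chebyshev.psi d - d| * kk 3 d :=
      Finset.sum_nonneg fun d hd => mul_nonneg (abs_nonneg _)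
        (Halasz.kk_nonneg (by norm_num) (Finset.mem_Icc.mp hd).1)
    nlinarith
  refine ⟨2 * C, by positivity, fun x w hw hwx => ?_⟩
  have hw0 : 0 < w := by linarith
  have hx3 : 3 ≤ x := by nlinarith
  have hx0 : 0 < x := by linarith
  have hxw3 : 3 ≤ x / w := by rw [le_div_iff₀ hw0]; linarith
  have hxwx : x / w ≤ x := div_le_self hx0.le hw
  have h1 := hC x hx3
  have h2 := hC (x / w) hxw3
  rw [← sum_abs_psi_sub_mul_kk_eq (by positivity) hxwx] at h2
  have hsplit : ∑ d ∈ Icc 1 ⌊x⌋₊, |Chebyshev.psi d - d| * (kk x d + w * kk (x / w) d) =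
      ∑ d ∈ Icc 1 ⌊x⌋₊, |Chebyshev.psi d - d| * kk x d + w * ∑ d ∈ Icc 1 ⌊x⌋₊, |Chebyshev.psi d - d| * kk (x / w) d := by
    rw [Finset.mul_sum, ← Finset.sum_add_distrib]
    refine Finset.sum_congr rfl fun d _ => ?_
    ring
  rw [hsplit]
  calc ∑ d ∈ Icc 1 ⌊x⌋₊, |Chebyshev.psi d - d| * kk x d + w * ∑ d ∈ Icc 1 ⌊x⌋₊, |Chebyshev.psi d - d| * kk (x / w) d
      ≤ C * x + w * (C * (x / w)) := add_le_add h1 (mul_le_mul_of_nonneg_left h2 hw0.le)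
    _ = 2 * C * x := by field_simp; ring

/-! ### From the sum `∑ ‖S(x/d) - wS(x/w/d)‖` to the integral -/

/-- The integrand `|S(e^u) - w S(e^u/w)| e^{-u}` is at most `2` (`w ≥ 0`). [folklore] -/
theorem normD_le_two (hfb : ∀ n, ‖f n‖ ≤ 1) (hw : 0 ≤ w) (u : ℝ) :
    ‖S f (Real.exp u) - (w : ℂ) * S f (Real.exp u / w)‖ * Real.exp (-u) ≤ 2 := by
  have he := Real.exp_pos u
  have h1 : ‖S f (Real.exp u)‖ ≤ Real.exp u := Halasz.norm_S_le' hfb he.le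
  have h2 : ‖(w : ℂ) * S f (Real.exp u / w)‖ ≤ Real.exp u := by
    rw [norm_mul, Complex.norm_real, Real.norm_of_nonneg hw]
    rcases hw.eq_or_lt with h0 | hw0
    · rw [← h0]; simp [he.le]
    · calc w * ‖S f (Real.exp u / w)‖ ≤ w * (Real.exp u / w) :=
            mul_le_mul_of_nonneg_left (Halasz.norm_S_le' hfb (by positivity)) hw
        _ = Real.exp u := by field_simp
  calc ‖S f (Real.exp u) - (w : ℂ) * S f (Real.exp u / w)‖ * Real.exp (-u)
      ≤ (Real.exp u + Real.exp u) * Real.exp (-u) := by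
        gcongr; exact (norm_sub_le _ _).trans (add_le_add h1 h2)
    _ = 2 := by rw [add_mul, ← Real.exp_add, add_neg_cancel, Real.exp_zero]; ring

/-- `u ↦ |S(e^u) - w S(e^u/w)| e^{-u}` is measurable. [folklore] -/
theorem measurable_normD (f : ℕ → ℂ) (w : ℝ) :
    Measurable fun u : ℝ => ‖S f (Real.exp u) - (w : ℂ) * S f (Real.exp u / w)‖ * Real.exp (-u) := by
  refine Measurable.mul (Measurable.norm ?_) (Real.measurable_exp.comp measurable_neg)
  exact ((Halasz.measurable_S f).comp Real.measurable_exp).sub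
    (((Halasz.measurable_S f).comp (Real.measurable_exp.div_const w)).const_mul _)

/-- `u ↦ |S(e^u) - w S(e^u/w)| e^{-u}` is interval integrable (bounded measurable). [folklore] -/
theorem intervalIntegrable_normD (hfb : ∀ n, ‖f n‖ ≤ 1) (hw : 0 ≤ w) (a b : ℝ) :
    IntervalIntegrable (fun u : ℝ => ‖S f (Real.exp u) - (w : ℂ) * S f (Real.exp u / w)‖ * Real.exp (-u)) volume a b := by
  refine IntervalIntegrable.mono_fun' (g := fun _ => (2 : ℝ)) intervalIntegrable_const
    (measurable_normD f w).aestronglyMeasurable (Filter.Eventually.of_forall fun u => ?_)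
  show ‖‖S f (Real.exp u) - (w : ℂ) * S f (Real.exp u / w)‖ * Real.exp (-u)‖ ≤ 2
  rw [Real.norm_of_nonneg (by positivity)]
  exact normD_le_two hfb hw u

/-- The per-`d` inequality: for `1 ≤ d`, `x > 0`, `w ≥ 1`,
`‖S(x/d) - wS(x/w/d)‖ - (k_d(x) + w k_d(x/w)) ≤ x ∫_{log(x/(d+1))}^{log(x/d)} |S(e^u) - wS(e^u/w)| e^{-u} du`.
[folklore] -/
theorem norm_Sdiff_sub_kk_le (hfb : ∀ n, ‖f n‖ ≤ 1) (hx : 0 < x) (hw : 1 ≤ w) {d : ℕ} (hd : 1 ≤ d) :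
    ‖S f (x / d) - (w : ℂ) * S f (x / w / d)‖ - (kk x d + w * kk (x / w) d) ≤
      x * ∫ u in Real.log (x / (d + 1))..Real.log (x / d),
        ‖S f (Real.exp u) - (w : ℂ) * S f (Real.exp u / w)‖ * Real.exp (-u) := by
  have hd0 : (0 : ℝ) < d := by exact_mod_cast hd
  have hw0 : 0 < w := by linarith
  set α := Real.log (x / (d + 1)) with hα
  set β := Real.log (x / d) with hβ
  set V : ℝ := ‖S f (x / d) - (w : ℂ) * S f (x / w / d)‖ - (kk x d + w * kk (x / w) d) with hV
  have hxd1 : 0 < x / (d + 1) := by positivity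
  have hxd : 0 < x / d := by positivity
  have hle : x / (d + 1) ≤ x / d := div_le_div_of_nonneg_left hx.le hd0 (by linarith)
  have hαβ : α ≤ β := Real.log_le_log hxd1 hle
  -- pointwise lower bound on `[α, β]`
  have hpt : ∀ u ∈ Set.Icc α β, V * Real.exp (-u) ≤
      ‖S f (Real.exp u) - (w : ℂ) * S f (Real.exp u / w)‖ * Real.exp (-u) := by
    intro u hu
    refine mul_le_mul_of_nonneg_right ?_ (Real.exp_pos _).le
    have hu1 : x / (d + 1) ≤ Real.exp u := by
      calc x / (d + 1) = Real.exp α := (Real.exp_log hxd1).symm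
        _ ≤ Real.exp u := Real.exp_le_exp.mpr hu.1
    have hu2 : Real.exp u ≤ x / d := by
      calc Real.exp u ≤ Real.exp β := Real.exp_le_exp.mpr hu.2
        _ = x / d := Real.exp_log hxd
    have hu1w : x / w / (d + 1) ≤ Real.exp u / w := by
      rw [div_right_comm]; exact div_le_div_of_nonneg_right hu1 hw0.le
    have hu2w : Real.exp u / w ≤ x / w / d := by
      rw [div_right_comm x w d]; exact div_le_div_of_nonneg_right hu2 hw0.le
    have hfl1 : ⌊x / (d + 1)⌋₊ ≤ ⌊Real.exp u⌋₊ := Nat.floor_le_floor hu1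
    have hfl2 : ⌊Real.exp u⌋₊ ≤ ⌊x / d⌋₊ := Nat.floor_le_floor hu2
    have hfl1w : ⌊x / w / (d + 1)⌋₊ ≤ ⌊Real.exp u / w⌋₊ := Nat.floor_le_floor hu1w
    have hfl2w : ⌊Real.exp u / w⌋₊ ≤ ⌊x / w / d⌋₊ := Nat.floor_le_floor hu2w
    have hsub := Halasz.norm_S_sub_S_le hfb hfl2 (g := f)
    have hsubw := Halasz.norm_S_sub_S_le hfb hfl2w (g := f)
    have hid : S f (x / d) - (w : ℂ) * S f (x / w / d) =
        (S f (Real.exp u) - (w : ℂ) * S f (Real.exp u / w)) +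
          ((S f (x / d) - S f (Real.exp u)) - (w : ℂ) * (S f (x / w / d) - S f (Real.exp u / w))) := by ring
    have htri : ‖S f (x / d) - (w : ℂ) * S f (x / w / d)‖ ≤
        ‖S f (Real.exp u) - (w : ℂ) * S f (Real.exp u / w)‖ +
          (‖S f (x / d) - S f (Real.exp u)‖ + w * ‖S f (x / w / d) - S f (Real.exp u / w)‖) := by
      rw [hid]
      refine (norm_add_le _ _).trans (add_le_add le_rfl ((norm_sub_le _ _).trans ?_))
      rw [norm_mul, Complex.norm_real, Real.norm_of_nonneg hw0.le]
    have hk : (⌊x / d⌋₊ : ℝ) - ⌊Real.exp u⌋₊ ≤ kk x d := by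
      unfold kk
      have : (⌊x / (d + 1)⌋₊ : ℝ) ≤ ⌊Real.exp u⌋₊ := by exact_mod_cast hfl1
      linarith
    have hkw : (⌊x / w / d⌋₊ : ℝ) - ⌊Real.exp u / w⌋₊ ≤ kk (x / w) d := by
      unfold kk
      have : (⌊x / w / (d + 1)⌋₊ : ℝ) ≤ ⌊Real.exp u / w⌋₊ := by exact_mod_cast hfl1w
      linarith
    have hwk : w * ‖S f (x / w / d) - S f (Real.exp u / w)‖ ≤ w * kk (x / w) d :=
      mul_le_mul_of_nonneg_left (hsubw.trans hkw) hw0.le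
    simp only [hV]
    linarith
  -- integrate
  have hI : ∫ u in α..β, V * Real.exp (-u) = V * ((d + 1) / x - d / x) := by
    rw [intervalIntegral.integral_const_mul]
    congr 1
    rw [intervalIntegral.integral_comp_neg (fun u => Real.exp u), integral_exp]
    rw [hα, hβ, Real.exp_neg, Real.exp_neg, Real.exp_log hxd1, Real.exp_log hxd, inv_div, inv_div]
  have hmono : ∫ u in α..β, V * Real.exp (-u) ≤
      ∫ u in α..β, ‖S f (Real.exp u) - (w : ℂ) * S f (Real.exp u / w)‖ * Real.exp (-u) :=
    intervalIntegral.integral_mono_on hαβ ((continuous_const.mul (by fun_prop)).intervalIntegrable _ _)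
      (intervalIntegrable_normD hfb hw0.le _ _) hpt
  rw [hI] at hmono
  have hx1 : V * ((d + 1) / x - d / x) = V / x := by
    field_simp; ring
  rw [hx1, div_le_iff₀ hx] at hmono
  linarith

/-- Telescoping: `∑_{d ≤ ⌊x⌋} k_d(z) ≤ z` for `0 ≤ z`. [folklore] -/
theorem sum_kk_le {z : ℝ} (hz : 0 ≤ z) (Y : ℕ) : ∑ d ∈ Icc 1 Y, kk z d ≤ z := by
  have h := Halasz.sum_Icc_sub_succ (fun d : ℕ => (⌊z / d⌋₊ : ℝ)) Y
  simp only [Nat.cast_add, Nat.cast_one] at h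
  unfold kk
  rw [h]
  have h1 : ((⌊z / (1 : ℕ)⌋₊ : ℕ) : ℝ) ≤ z := by
    rw [Nat.cast_one, div_one]; exact Nat.floor_le hz
  have h2 : (0 : ℝ) ≤ ⌊z / ((Y : ℝ) + 1)⌋₊ := Nat.cast_nonneg _
  push_cast at h1 h2 ⊢
  linarith

/-- **Sum versus integral for the differences**: for `x ≥ 1`, `w ≥ 1`,
`∑_{d ≤ x} ‖S(x/d) - wS(x/w/d)‖ ≤ x ∫_{log(x/(⌊x⌋+1))}^{log x} |S(e^u) - wS(e^u/w)| e^{-u} du + 2x`. [folklore] -/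
theorem sum_norm_Sdiff_le (hfb : ∀ n, ‖f n‖ ≤ 1) (hx : 1 ≤ x) (hw : 1 ≤ w) :
    ∑ d ∈ Icc 1 ⌊x⌋₊, ‖S f (x / d) - (w : ℂ) * S f (x / w / d)‖ ≤
      x * (∫ u in Real.log (x / (⌊x⌋₊ + 1))..Real.log x,
        ‖S f (Real.exp u) - (w : ℂ) * S f (Real.exp u / w)‖ * Real.exp (-u)) + 2 * x := by
  have hx0 : 0 < x := by linarith
  have hw0 : 0 < w := by linarith
  set Y := ⌊x⌋₊ with hY
  set nD : ℝ → ℝ := fun u => ‖S f (Real.exp u) - (w : ℂ) * S f (Real.exp u / w)‖ * Real.exp (-u) with hnD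
  set a : ℕ → ℝ := fun d => ‖S f (x / d) - (w : ℂ) * S f (x / w / d)‖ with ha
  have hY1 : 1 ≤ Y := Nat.le_floor (by simpa using hx)
  -- the break points `e k = log(x/(Y+1-k))`
  set e : ℕ → ℝ := fun k => Real.log (x / ((Y + 1 - k : ℕ) : ℝ)) with he
  have he0 : e 0 = Real.log (x / (Y + 1)) := by simp [he]
  have heY : e Y = Real.log x := by
    simp only [he]; rw [show Y + 1 - Y = 1 by omega]; simp
  -- per-`k` inequality
  have hk : ∀ k ∈ Finset.range Y,
      a (Y - k) - (kk x (Y - k) + w * kk (x / w) (Y - k)) ≤ x * ∫ u in e k..e (k + 1), nD u := by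
    intro k hkY
    rw [Finset.mem_range] at hkY
    have h := norm_Sdiff_sub_kk_le hfb hx0 hw (d := Y - k) (by omega)
    have h1 : Real.log (x / (((Y - k : ℕ) : ℝ) + 1)) = e k := by
      simp only [he]; congr 2; rw [show Y + 1 - k = (Y - k) + 1 by omega]; push_cast; ring
    have h2 : Real.log (x / ((Y - k : ℕ) : ℝ)) = e (k + 1) := by
      simp only [he]; congr 2; rw [show Y + 1 - (k + 1) = Y - k by omega]
    rw [h1, h2] at h
    exact h
  have hsum := Finset.sum_le_sum hk
  rw [← Finset.mul_sum, intervalIntegral.sum_integral_adjacent_intervals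
    (fun k _ => intervalIntegrable_normD hfb hw0.le _ _), he0, heY] at hsum
  -- reindex the left-hand side
  have hreindex : ∑ k ∈ Finset.range Y, (a (Y - k) - (kk x (Y - k) + w * kk (x / w) (Y - k))) =
      ∑ d ∈ Icc 1 Y, (a d - (kk x d + w * kk (x / w) d)) := by
    have h1 := Finset.sum_range_reflect (fun k => a (k + 1) - (kk x (k + 1) + w * kk (x / w) (k + 1))) Y
    have h2 : ∀ k ∈ Finset.range Y, (a ((Y - 1 - k) + 1) - (kk x ((Y - 1 - k) + 1) + w * kk (x / w) ((Y - 1 - k) + 1))) =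
        (a (Y - k) - (kk x (Y - k) + w * kk (x / w) (Y - k))) := by
      intro k hkY
      rw [Finset.mem_range] at hkY
      rw [show Y - 1 - k + 1 = Y - k by omega]
    rw [← Finset.sum_congr rfl h2, h1, show Icc 1 Y = Ico 1 (1 + Y) by
      ext d; simp only [Finset.mem_Icc, Finset.mem_Ico]; omega, Finset.sum_Ico_eq_sum_range,
      Nat.add_sub_cancel_left]
    refine Finset.sum_congr rfl fun k _ => ?_
    rw [add_comm 1 k]
  rw [hreindex, Finset.sum_sub_distrib] at hsum
  have hkk : ∑ d ∈ Icc 1 Y, (kk x d + w * kk (x / w) d) ≤ 2 * x := by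
    rw [Finset.sum_add_distrib, ← Finset.mul_sum]
    have h1 := sum_kk_le hx0.le Y
    have h2 := sum_kk_le (div_nonneg hx0.le hw0.le) Y
    calc ∑ d ∈ Icc 1 Y, kk x d + w * ∑ d ∈ Icc 1 Y, kk (x / w) d ≤ x + w * (x / w) :=
          add_le_add h1 (mul_le_mul_of_nonneg_left h2 hw0.le)
      _ = 2 * x := by field_simp; ring
  linarith

/-- **Granville–Soundararajan 2003, Lemma 2.1, (2.2)** (logarithmic scale): there is an absolute `C`
such that for every multiplicative `f : ℕ → ℂ` with `|f| ≤ 1`, every `w ≥ 1` and `x ≥ 3w`,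
`‖S(x) - w S(x/w)‖/x · log x ≤ ∫_{log 2w}^{log x} |S(e^u) - wS(e^u/w)| e^{-u} du + C log 2w`, i.e.
`|S(x)/x - S(x/w)/(x/w)| ≤ (1/log x) ∫_{2w}^x |S(y)/y - S(y/w)/(y/w)| dy/y + O(log 2w/log x)`
(`S(z) = ∑_{n ≤ z} f(n)`; the printed range is `1 ≤ w ≤ x`, the complement `x/3 < w ≤ x` being trivial).
[cite: GranvilleSoundararajan2003, Lemma 2.1, (2.2)] -/
theorem exists_norm_S_sub_mul_log_le_integral :
    ∃ C : ℝ, 0 ≤ C ∧ ∀ f : ℕ → ℂ, (∀ m n, Nat.Coprime m n → f (m * n) = f m * f n) → (∀ n, ‖f n‖ ≤ 1) →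
      ∀ x w : ℝ, 1 ≤ w → 3 * w ≤ x →
        ‖S f x - (w : ℂ) * S f (x / w)‖ / x * Real.log x ≤
          (∫ u in Real.log (2 * w)..Real.log x,
              ‖S f (Real.exp u) - (w : ℂ) * S f (Real.exp u / w)‖ * Real.exp (-u)) +
            C * Real.log (2 * w) := by
  obtain ⟨C₂, hC₂, hsum⟩ := exists_norm_S_sub_mul_log_le_sum
  obtain ⟨C_E, hCE, hE⟩ := exists_sum_abs_psi_sub_mul_kk_add_le
  have hlog2 : (0.69 : ℝ) < Real.log 2 := by have := Real.log_two_gt_d9; linarith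
  refine ⟨5 + (2 + C_E + C₂) / Real.log 2, by positivity, fun f hf hfb x w hw hwx => ?_⟩
  have hw0 : 0 < w := by linarith
  have hx3 : 3 ≤ x := by nlinarith
  have hx0 : 0 < x := by linarith
  have hx1 : 1 ≤ x := by linarith
  set Y := ⌊x⌋₊ with hY
  set nD : ℝ → ℝ := fun u => ‖S f (Real.exp u) - (w : ℂ) * S f (Real.exp u / w)‖ * Real.exp (-u) with hnD
  set a : ℕ → ℝ := fun d => ‖S f (x / d) - (w : ℂ) * S f (x / w / d)‖ with ha
  -- step 1: (2.3) twice
  have h1 := hsum f hf hfb x w hw hx0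
  -- step 2: Abel against PNT
  have haY : a (Y + 1) = 0 := by
    have hlt : x / ((Y + 1 : ℕ) : ℝ) < 1 := by
      rw [div_lt_one (by positivity)]; push_cast; exact Nat.lt_floor_add_one x
    have hltw : x / w / ((Y + 1 : ℕ) : ℝ) < 1 :=
      lt_of_le_of_lt (div_le_div_of_nonneg_right (div_le_self hx0.le hw) (by positivity)) hlt
    simp only [ha]
    rw [Halasz.S_of_lt_one f hlt, Halasz.S_of_lt_one f hltw]
    simp
  have h2 := sum_vonMangoldt_mul_le_of_abs_sub_le (a := a) (k := fun d => kk x d + w * kk (x / w) d) Y haY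
    (fun d hd => by
      have := abs_norm_Sdiff_sub_le hfb hx0.le hw0.le (Finset.mem_Icc.mp hd).1
      simp only [ha]
      push_cast
      exact this)
  have h3 := hE x w hw hwx
  -- step 3: sum versus integral
  have h4 := sum_norm_Sdiff_le hfb hx1 hw
  -- step 4: the integral below `log 2w`
  have hlow : Real.log (x / (Y + 1)) ≤ Real.log (2 * w) := by
    refine Real.log_le_log (by positivity) ?_
    have : x / (Y + 1) ≤ 1 := by
      rw [div_le_one (by positivity)]; exact (Nat.lt_floor_add_one x).le
    linarith
  have hlow2 : -Real.log 2 ≤ Real.log (x / (Y + 1)) := by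
    rw [← Real.log_inv]
    refine Real.log_le_log (by norm_num) ?_
    rw [le_div_iff₀ (by positivity)]
    have hYx : (Y : ℝ) ≤ x := Nat.floor_le hx0.le
    nlinarith
  have hsplit : ∫ u in Real.log (x / (Y + 1))..Real.log x, nD u =
      (∫ u in Real.log (x / (Y + 1))..Real.log (2 * w), nD u) + ∫ u in Real.log (2 * w)..Real.log x, nD u :=
    (intervalIntegral.integral_add_adjacent_intervals (intervalIntegrable_normD hfb hw0.le _ _)
      (intervalIntegrable_normD hfb hw0.le _ _)).symm
  have hsmall : ∫ u in Real.log (x / (Y + 1))..Real.log (2 * w), nD u ≤ 4 * Real.log (2 * w) := by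
    have hlog2w : Real.log 2 ≤ Real.log (2 * w) := Real.log_le_log (by norm_num) (by linarith)
    calc ∫ u in Real.log (x / (Y + 1))..Real.log (2 * w), nD u
        ≤ ∫ u in Real.log (x / (Y + 1))..Real.log (2 * w), (2 : ℝ) :=
          intervalIntegral.integral_mono_on hlow (intervalIntegrable_normD hfb hw0.le _ _) intervalIntegrable_const
            (fun u _ => normD_le_two hfb hw0.le u)
      _ = 2 * (Real.log (2 * w) - Real.log (x / (Y + 1))) := by simp; ring
      _ ≤ 2 * (Real.log (2 * w) + Real.log 2) := by linarith
      _ ≤ 4 * Real.log (2 * w) := by linarith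
  -- combine
  have hkey : ‖S f x - (w : ℂ) * S f (x / w)‖ * Real.log x ≤
      x * (∫ u in Real.log (2 * w)..Real.log x, nD u) + x * (4 * Real.log (2 * w) + 2 + C_E + C₂ + Real.log w) := by
    have e1 : ∑ d ∈ Icc 1 Y, Λ d * a d ≤ ∑ d ∈ Icc 1 Y, a d + C_E * x := by linarith
    have e2 : ∑ d ∈ Icc 1 Y, a d ≤ x * ((∫ u in Real.log (x / (Y + 1))..Real.log (2 * w), nD u) +
        ∫ u in Real.log (2 * w)..Real.log x, nD u) + 2 * x := by rw [← hsplit]; exact h4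
    have e3 : x * ((∫ u in Real.log (x / (Y + 1))..Real.log (2 * w), nD u) + ∫ u in Real.log (2 * w)..Real.log x, nD u) ≤
        x * (4 * Real.log (2 * w) + ∫ u in Real.log (2 * w)..Real.log x, nD u) := by
      refine mul_le_mul_of_nonneg_left ?_ hx0.le; linarith
    nlinarith
  have hlogw : Real.log w ≤ Real.log (2 * w) := Real.log_le_log hw0 (by linarith)
  have hlog2w0 : Real.log 2 ≤ Real.log (2 * w) := Real.log_le_log (by norm_num) (by linarith)
  have hconst : 4 * Real.log (2 * w) + 2 + C_E + C₂ + Real.log w ≤ (5 + (2 + C_E + C₂) / Real.log 2) * Real.log (2 * w) := by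
    have hq : 2 + C_E + C₂ ≤ (2 + C_E + C₂) / Real.log 2 * Real.log (2 * w) := by
      rw [div_mul_eq_mul_div, le_div_iff₀ (by linarith)]
      exact mul_le_mul_of_nonneg_left hlog2w0 (by positivity)
    nlinarith
  rw [div_mul_eq_mul_div, div_le_iff₀ hx0]
  calc ‖S f x - (w : ℂ) * S f (x / w)‖ * Real.log x
      ≤ x * (∫ u in Real.log (2 * w)..Real.log x, nD u) + x * (4 * Real.log (2 * w) + 2 + C_E + C₂ + Real.log w) := hkey
    _ ≤ x * (∫ u in Real.log (2 * w)..Real.log x, nD u) + x * ((5 + (2 + C_E + C₂) / Real.log 2) * Real.log (2 * w)) := by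
        gcongr
    _ = ((∫ u in Real.log (2 * w)..Real.log x, nD u) + (5 + (2 + C_E + C₂) / Real.log 2) * Real.log (2 * w)) * x := by
        ring

/-! ### The kernel step ((3.7) for the differences, proof of Proposition 3.3) -/

variable {g : ℕ → ℂ}

/-- On `u ∈ (log 2w, log x]` (`x ≥ 1`, `w ≥ 1`, `c ≥ 0`) the twisted kernel is bounded:
`|A(e^u) - wA(e^u/w)| e^{-cu} ≤ 2 x log x` (`A = ∑_{n ≤ ·} g̃(n) log n`). [folklore] -/
theorem norm_twisted_kernel_le (hgb : ∀ n, ‖g n‖ ≤ 1) (N : ℕ) {x w c u : ℝ} (hx : 1 ≤ x) (hw : 1 ≤ w)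
    (hc : 0 ≤ c) (hu : u ∈ Set.Ioc (Real.log (2 * w)) (Real.log x)) :
    ‖psum (mulLog g N) (Real.exp u) - (w : ℂ) * psum (mulLog g N) (Real.exp u / w)‖ * Real.exp (-(c * u)) ≤
      2 * (x * Real.log x) := by
  have hx0 : 0 < x := by linarith
  have hw0 : 0 < w := by linarith
  have hlog2w : 0 < Real.log (2 * w) := Real.log_pos (by linarith)
  have hu0 : 0 < u := hlog2w.trans hu.1
  have hexu : Real.exp u ≤ x := by
    calc Real.exp u ≤ Real.exp (Real.log x) := Real.exp_le_exp.2 hu.2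
      _ = x := Real.exp_log hx0
  have hwu : w ≤ Real.exp u := by
    have h2w : Real.log w ≤ Real.log (2 * w) := Real.log_le_log hw0 (by linarith)
    have : Real.log w ≤ u := by linarith [hu.1]
    calc w = Real.exp (Real.log w) := (Real.exp_log hw0).symm
      _ ≤ Real.exp u := Real.exp_le_exp.2 this
  have h1e : 1 ≤ Real.exp u := by simpa using Real.one_le_exp hu0.le
  have h1ew : 1 ≤ Real.exp u / w := by rw [le_div_iff₀ hw0, one_mul]; exact hwu
  have hlx0 : 0 ≤ Real.log x := Real.log_nonneg hx
  have hA1 : ‖psum (mulLog g N) (Real.exp u)‖ ≤ x * Real.log x := by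
    refine (Halasz.norm_psum_mulLog_le_mul_log hgb N h1e).trans ?_
    rw [Real.log_exp]
    exact mul_le_mul hexu hu.2 hu0.le hx0.le
  have hA2 : ‖(w : ℂ) * psum (mulLog g N) (Real.exp u / w)‖ ≤ x * Real.log x := by
    rw [norm_mul, Complex.norm_real, Real.norm_of_nonneg hw0.le]
    have h2 := Halasz.norm_psum_mulLog_le_mul_log hgb N h1ew
    have hle : Real.exp u / w ≤ x := (div_le_self (Real.exp_pos u).le hw).trans hexu
    have hlog : Real.log (Real.exp u / w) ≤ Real.log x := Real.log_le_log (by positivity) hle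
    have hlog0 : 0 ≤ Real.log (Real.exp u / w) := Real.log_nonneg h1ew
    calc w * ‖psum (mulLog g N) (Real.exp u / w)‖ ≤ w * (Real.exp u / w * Real.log (Real.exp u / w)) :=
          mul_le_mul_of_nonneg_left h2 hw0.le
      _ = Real.exp u * Real.log (Real.exp u / w) := by field_simp
      _ ≤ x * Real.log x := mul_le_mul hexu hlog hlog0 hx0.le
  have hexple : Real.exp (-(c * u)) ≤ 1 := by
    rw [Real.exp_le_one_iff, neg_nonpos]
    exact mul_nonneg hc hu0.le
  have hxl : 0 ≤ x * Real.log x := by positivity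
  calc ‖psum (mulLog g N) (Real.exp u) - (w : ℂ) * psum (mulLog g N) (Real.exp u / w)‖ * Real.exp (-(c * u))
      ≤ (x * Real.log x + x * Real.log x) * 1 :=
        mul_le_mul ((norm_sub_le _ _).trans (add_le_add hA1 hA2)) hexple (Real.exp_pos _).le (by positivity)
    _ = 2 * (x * Real.log x) := by ring

/-- The twisted kernel `(α, u) ↦ |A(e^u) - wA(e^u/w)| e^{-(1+2α)u}` is measurable on `ℝ × ℝ`. [folklore] -/
theorem measurable_twisted_kernel (g : ℕ → ℂ) (N : ℕ) (w : ℝ) :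
    Measurable fun p : ℝ × ℝ =>
      ‖psum (mulLog g N) (Real.exp p.2) - (w : ℂ) * psum (mulLog g N) (Real.exp p.2 / w)‖ *
        Real.exp (-((1 + 2 * p.1) * p.2)) := by
  refine Measurable.mul (Measurable.norm ?_) (Real.measurable_exp.comp (by fun_prop))
  refine Measurable.sub ((MellinPlancherel.measurable_psum _).comp (Real.measurable_exp.comp measurable_snd)) ?_
  exact ((MellinPlancherel.measurable_psum _).comp ((Real.measurable_exp.comp measurable_snd).div_const w)).const_mul _

/-- The twisted kernel is integrable on the rectangle `(α₀, 1] × (log 2w, log x]` (`α₀ ≥ 0`, `x, w ≥ 1`).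
[folklore] -/
theorem integrable_twisted_kernel (hgb : ∀ n, ‖g n‖ ≤ 1) (N : ℕ) {x w α₀ : ℝ} (hx : 1 ≤ x) (hw : 1 ≤ w)
    (hα₀ : 0 ≤ α₀) :
    Integrable (fun p : ℝ × ℝ =>
        ‖psum (mulLog g N) (Real.exp p.2) - (w : ℂ) * psum (mulLog g N) (Real.exp p.2 / w)‖ *
          Real.exp (-((1 + 2 * p.1) * p.2)))
      ((volume.restrict (Set.Ioc α₀ 1)).prod
        (volume.restrict (Set.Ioc (Real.log (2 * w)) (Real.log x)))) := by
  rw [Measure.prod_restrict, ← Measure.volume_eq_prod]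
  refine Measure.integrableOn_of_bounded (M := 2 * (x * Real.log x)) ?_
    (measurable_twisted_kernel g N w).aestronglyMeasurable ?_
  · rw [Measure.volume_eq_prod, Measure.prod_prod]
    exact ENNReal.mul_ne_top measure_Ioc_lt_top.ne measure_Ioc_lt_top.ne
  · refine ae_restrict_of_forall_mem (measurableSet_Ioc.prod measurableSet_Ioc) fun p hp => ?_
    obtain ⟨⟨hα1, -⟩, hu⟩ := hp
    rw [Real.norm_of_nonneg (by positivity)]
    have hc : 0 ≤ 1 + 2 * p.1 := by linarith [hα₀.trans hα1.le]
    exact norm_twisted_kernel_le hgb N hx hw hc hu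

/-- **(A1) for the differences, in logarithmic coordinates**: for `w ≥ 1`, `log 2w ≤ u` and
`⌊e^u⌋ ≤ N`, with `A = ∑_{n ≤ ·} f̃(n) log n` (`f̃` the `(N+1)`-smooth truncation),
`|S(e^u) - wS(e^u/w)| e^{-u} ≤ |A(e^u) - wA(e^u/w)| e^{-u}/u + 3 log(2w)/u`.
[cite: GranvilleSoundararajan2003, proof of Proposition 3.3 ("Arguing as in (3.7)")] -/
theorem normD_le (hfb : ∀ n, ‖f n‖ ≤ 1) {N : ℕ} {w u : ℝ} (hw : 1 ≤ w) (hu : Real.log (2 * w) ≤ u)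
    (huN : ⌊Real.exp u⌋₊ ≤ N) :
    ‖S f (Real.exp u) - (w : ℂ) * S f (Real.exp u / w)‖ * Real.exp (-u) ≤
      ‖psum (mulLog f N) (Real.exp u) - (w : ℂ) * psum (mulLog f N) (Real.exp u / w)‖ * Real.exp (-u) / u +
        3 * Real.log (2 * w) / u := by
  have hw0 : 0 < w := by linarith
  have hlog2 : (0.69 : ℝ) < Real.log 2 := by have := Real.log_two_gt_d9; linarith
  have hlog2w : Real.log 2 ≤ Real.log (2 * w) := Real.log_le_log (by norm_num) (by linarith)
  have hu0 : 0 < u := by linarith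
  set y : ℝ := Real.exp u with hy
  have hy0 : 0 < y := Real.exp_pos u
  have hwy : 2 * w ≤ y := by
    calc 2 * w = Real.exp (Real.log (2 * w)) := (Real.exp_log (by linarith)).symm
      _ ≤ y := Real.exp_le_exp.2 hu
  have hy1 : 1 ≤ y := by linarith
  have hy' : 1 ≤ y / w := by rw [le_div_iff₀ hw0]; linarith
  have hy'0 : 0 < y / w := by positivity
  have huN' : ⌊y / w⌋₊ ≤ N := (Nat.floor_le_floor (div_le_self hy0.le hw)).trans huN
  -- the identity
  have hlogy : (Real.log y : ℂ) = (Real.log (y / w) : ℂ) + (Real.log w : ℂ) := by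
    rw [← Complex.ofReal_add, Real.log_div hy0.ne' hw0.ne']; ring_nf
  have hdec := S_mul_log_eq f hy0
  have hdec' := S_mul_log_eq f hy'0
  rw [← Halasz.psum_mulLog_eq_sum huN] at hdec
  rw [← Halasz.psum_mulLog_eq_sum huN'] at hdec'
  set R : ℂ := ∑ n ∈ Icc 1 ⌊y⌋₊, f n * (Real.log (y / n) : ℂ) with hR
  set R' : ℂ := ∑ n ∈ Icc 1 ⌊y / w⌋₊, f n * (Real.log (y / w / n) : ℂ) with hR'
  have hid : (S f y - (w : ℂ) * S f (y / w)) * (Real.log y : ℂ) =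
      (psum (mulLog f N) y - (w : ℂ) * psum (mulLog f N) (y / w)) + R - (w : ℂ) * R' -
        (w : ℂ) * S f (y / w) * (Real.log w : ℂ) := by
    have e1 : S f y * (Real.log y : ℂ) = psum (mulLog f N) y + R := hdec
    have e2 : S f (y / w) * (Real.log (y / w) : ℂ) = psum (mulLog f N) (y / w) + R' := hdec'
    calc (S f y - (w : ℂ) * S f (y / w)) * (Real.log y : ℂ)
        = S f y * (Real.log y : ℂ) - (w : ℂ) * (S f (y / w) * (Real.log (y / w) : ℂ)) -
            (w : ℂ) * S f (y / w) * (Real.log w : ℂ) := by rw [hlogy]; ring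
      _ = _ := by rw [e1, e2]; ring
  have hRle : ‖R‖ ≤ y := norm_sum_mul_log_div_le hfb hy1
  have hR'le : ‖R'‖ ≤ y / w := norm_sum_mul_log_div_le hfb hy'
  have hlast : ‖(w : ℂ) * S f (y / w) * (Real.log w : ℂ)‖ ≤ y * Real.log w := by
    rw [norm_mul, norm_mul, Complex.norm_real, Complex.norm_real, Real.norm_of_nonneg hw0.le,
      Real.norm_of_nonneg (Real.log_nonneg hw)]
    have hS := Halasz.norm_S_le' hfb hy'0.le (g := f)
    have hlw : 0 ≤ Real.log w := Real.log_nonneg hw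
    calc w * ‖S f (y / w)‖ * Real.log w ≤ w * (y / w) * Real.log w := by gcongr
      _ = y * Real.log w := by field_simp
  have hwR' : ‖(w : ℂ) * R'‖ ≤ y := by
    rw [norm_mul, Complex.norm_real, Real.norm_of_nonneg hw0.le]
    calc w * ‖R'‖ ≤ w * (y / w) := mul_le_mul_of_nonneg_left hR'le hw0.le
      _ = y := by field_simp
  have hnorm : ‖S f y - (w : ℂ) * S f (y / w)‖ * u = ‖(S f y - (w : ℂ) * S f (y / w)) * (Real.log y : ℂ)‖ := by
    rw [norm_mul, Complex.norm_real, hy, Real.log_exp, Real.norm_of_nonneg hu0.le]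
  have hmain : ‖S f y - (w : ℂ) * S f (y / w)‖ * u ≤
      ‖psum (mulLog f N) y - (w : ℂ) * psum (mulLog f N) (y / w)‖ + y * (2 + Real.log w) := by
    rw [hnorm, hid]
    calc ‖(psum (mulLog f N) y - (w : ℂ) * psum (mulLog f N) (y / w)) + R - (w : ℂ) * R' -
          (w : ℂ) * S f (y / w) * (Real.log w : ℂ)‖
        ≤ ‖psum (mulLog f N) y - (w : ℂ) * psum (mulLog f N) (y / w)‖ + ‖R‖ + ‖(w : ℂ) * R'‖ +
            ‖(w : ℂ) * S f (y / w) * (Real.log w : ℂ)‖ := by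
          refine (norm_sub_le _ _).trans (add_le_add ((norm_sub_le _ _).trans (add_le_add (norm_add_le _ _) le_rfl)) le_rfl)
      _ ≤ ‖psum (mulLog f N) y - (w : ℂ) * psum (mulLog f N) (y / w)‖ + y + y + y * Real.log w :=
          add_le_add (add_le_add (add_le_add le_rfl hRle) hwR') hlast
      _ = _ := by ring
  have h3 : 2 + Real.log w ≤ 3 * Real.log (2 * w) := by
    have : Real.log (2 * w) = Real.log 2 + Real.log w := Real.log_mul (by norm_num) hw0.ne'
    have hlw : 0 ≤ Real.log w := Real.log_nonneg hw
    rw [this]; linarith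
  -- divide by `u e^u`
  rw [← add_div, le_div_iff₀ hu0]
  have hexp : y * Real.exp (-u) = 1 := by rw [hy, ← Real.exp_add, add_neg_cancel, Real.exp_zero]
  calc ‖S f y - (w : ℂ) * S f (y / w)‖ * Real.exp (-u) * u = (‖S f y - (w : ℂ) * S f (y / w)‖ * u) * Real.exp (-u) := by ring
    _ ≤ (‖psum (mulLog f N) y - (w : ℂ) * psum (mulLog f N) (y / w)‖ + y * (2 + Real.log w)) * Real.exp (-u) :=
        mul_le_mul_of_nonneg_right hmain (Real.exp_pos _).le
    _ = ‖psum (mulLog f N) y - (w : ℂ) * psum (mulLog f N) (y / w)‖ * Real.exp (-u) + (2 + Real.log w) := by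
        rw [add_mul, mul_assoc y, mul_comm (2 + Real.log w) (Real.exp (-u)), ← mul_assoc y, hexp, one_mul]
    _ ≤ ‖psum (mulLog f N) y - (w : ℂ) * psum (mulLog f N) (y / w)‖ * Real.exp (-u) + 3 * Real.log (2 * w) := by
        linarith

/-- **GS03 (3.7) for the differences (proof of Proposition 3.3), one-sided**: for `w ≥ 1`, `2w ≤ x`,
with `N = ⌊x⌋`, `A = ∑_{n ≤ ·} f̃(n) log n` and `α₀ = 1/(2 log x)`,
`∫_{log 2w}^{log x} |S(e^u) - wS(e^u/w)| e^{-u} du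
  ≤ 17 ∫_{α₀}^{1} (∫_{log 2w}^{log x} |A(e^u) - wA(e^u/w)| e^{-(1+2α)u} du) dα + 3 log(2w) log(log x/log 2w)`.
[cite: GranvilleSoundararajan2003, proof of Proposition 3.3 (first display) and (3.7)] -/
theorem integral_normD_le (hfb : ∀ n, ‖f n‖ ≤ 1) {x w : ℝ} (hw : 1 ≤ w) (hwx : 2 * w ≤ x) :
    ∫ u in Real.log (2 * w)..Real.log x, ‖S f (Real.exp u) - (w : ℂ) * S f (Real.exp u / w)‖ * Real.exp (-u) ≤
      17 * (∫ α in Set.Ioc (1 / (2 * Real.log x)) 1,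
              ∫ u in Set.Ioc (Real.log (2 * w)) (Real.log x),
                ‖psum (mulLog f ⌊x⌋₊) (Real.exp u) - (w : ℂ) * psum (mulLog f ⌊x⌋₊) (Real.exp u / w)‖ *
                  Real.exp (-((1 + 2 * α) * u))) +
        3 * Real.log (2 * w) * Real.log (Real.log x / Real.log (2 * w)) := by
  set N : ℕ := ⌊x⌋₊ with hN
  set α₀ : ℝ := 1 / (2 * Real.log x) with hα₀
  set A : Set ℝ := Set.Ioc α₀ 1 with hA
  set T : Set ℝ := Set.Ioc (Real.log (2 * w)) (Real.log x) with hT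
  set K : ℝ → ℝ → ℝ := fun α u =>
    ‖psum (mulLog f N) (Real.exp u) - (w : ℂ) * psum (mulLog f N) (Real.exp u / w)‖ *
      Real.exp (-((1 + 2 * α) * u)) with hK
  set nD : ℝ → ℝ := fun u => ‖S f (Real.exp u) - (w : ℂ) * S f (Real.exp u / w)‖ * Real.exp (-u) with hnD
  have hlog2 : (0.6931471803 : ℝ) < Real.log 2 := Real.log_two_gt_d9
  have hw0 : 0 < w := by linarith
  have hx1 : (1 : ℝ) ≤ x := by linarith
  have hx0 : 0 < x := by linarith
  have hlog2w : Real.log 2 ≤ Real.log (2 * w) := Real.log_le_log (by norm_num) (by linarith)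
  have hl2w0 : 0 < Real.log (2 * w) := by linarith
  have hlx : Real.log (2 * w) ≤ Real.log x := Real.log_le_log (by linarith) hwx
  have hlx0 : 0 < Real.log x := by linarith
  have hα₀0 : 0 ≤ α₀ := by rw [hα₀]; positivity
  -- integrability of the kernel in both orders
  have hKint := integrable_twisted_kernel hfb N (w := w) hx1 hw hα₀0
  have hKint' : Integrable (Function.uncurry fun u α => K α u)
      ((volume.restrict T).prod (volume.restrict A)) := hKint.swap
  have hIu : Integrable (fun u => ∫ α in A, K α u) (volume.restrict T) := by
    have := hKint'.integral_prod_left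
    simpa [Function.uncurry] using this
  -- pointwise bound on `T`
  have hpt : ∀ u ∈ Set.Icc (Real.log (2 * w)) (Real.log x),
      nD u ≤ 17 * (∫ α in A, K α u) + 3 * Real.log (2 * w) * (1 / u) := by
    intro u hu
    have hu0 : 0 < u := by linarith [hu.1]
    have huN : ⌊Real.exp u⌋₊ ≤ N := by
      rw [hN]
      refine Nat.floor_le_floor ?_
      calc Real.exp u ≤ Real.exp (Real.log x) := Real.exp_le_exp.2 hu.2
        _ = x := Real.exp_log hx0
    refine (normD_le hfb hw hu.1 huN).trans ?_
    rw [mul_one_div]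
    gcongr ?_ + _
    have hrep := Halasz.inv_le_integral_exp (x := x) (hlog2w.trans hu.1) hu.2
    have hA0 : 0 ≤ ‖psum (mulLog f N) (Real.exp u) - (w : ℂ) * psum (mulLog f N) (Real.exp u / w)‖ * Real.exp (-u) := by
      positivity
    calc ‖psum (mulLog f N) (Real.exp u) - (w : ℂ) * psum (mulLog f N) (Real.exp u / w)‖ * Real.exp (-u) / u
        = ‖psum (mulLog f N) (Real.exp u) - (w : ℂ) * psum (mulLog f N) (Real.exp u / w)‖ * Real.exp (-u) * (1 / u) := by ring
      _ ≤ ‖psum (mulLog f N) (Real.exp u) - (w : ℂ) * psum (mulLog f N) (Real.exp u / w)‖ * Real.exp (-u) *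
            (17 * ∫ α in (1 / (2 * Real.log x))..1, Real.exp (-(2 * α * u))) := by gcongr
      _ = 17 * ∫ α in α₀..1, ‖psum (mulLog f N) (Real.exp u) - (w : ℂ) * psum (mulLog f N) (Real.exp u / w)‖ *
            Real.exp (-u) * Real.exp (-(2 * α * u)) := by
          rw [intervalIntegral.integral_const_mul]; ring
      _ = 17 * ∫ α in A, K α u := by
          rw [intervalIntegral.integral_of_le (by
            rw [hα₀]; rw [div_le_one (by positivity)]; linarith)]
          congr 1
          refine setIntegral_congr_fun measurableSet_Ioc fun α _ => ?_
          simp only [hK]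
          rw [mul_assoc, ← Real.exp_add]
          congr 2
          ring
  -- integrate the pointwise bound
  have hnormInt := intervalIntegrable_normD hfb hw0.le (Real.log (2 * w)) (Real.log x) (f := f)
  have hinvInt : IntervalIntegrable (fun u : ℝ => 3 * Real.log (2 * w) * (1 / u)) volume (Real.log (2 * w)) (Real.log x) := by
    refine ((continuousOn_const.div continuousOn_id fun u hu => ?_).intervalIntegrable).const_mul _
    rw [Set.uIcc_of_le hlx] at hu
    exact (ne_of_gt (by linarith [hu.1] : (0:ℝ) < u))
  have hRint : IntervalIntegrable (fun u => 17 * (∫ α in A, K α u) + 3 * Real.log (2 * w) * (1 / u)) volume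
      (Real.log (2 * w)) (Real.log x) := by
    refine IntervalIntegrable.add ?_ hinvInt
    rw [intervalIntegrable_iff_integrableOn_Ioc_of_le hlx]
    exact hIu.const_mul 17
  calc ∫ u in Real.log (2 * w)..Real.log x, nD u
      ≤ ∫ u in Real.log (2 * w)..Real.log x, (17 * (∫ α in A, K α u) + 3 * Real.log (2 * w) * (1 / u)) :=
        intervalIntegral.integral_mono_on hlx hnormInt hRint hpt
    _ = 17 * (∫ u in Real.log (2 * w)..Real.log x, ∫ α in A, K α u) +
          3 * Real.log (2 * w) * ∫ u in Real.log (2 * w)..Real.log x, 1 / u := by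
        rw [intervalIntegral.integral_add ?_ hinvInt, intervalIntegral.integral_const_mul,
          intervalIntegral.integral_const_mul]
        rw [intervalIntegrable_iff_integrableOn_Ioc_of_le hlx]
        exact hIu.const_mul 17
    _ = 17 * (∫ α in A, ∫ u in T, K α u) + 3 * Real.log (2 * w) * Real.log (Real.log x / Real.log (2 * w)) := by
        congr 2
        · rw [intervalIntegral.integral_of_le hlx]
          exact integral_integral_swap hKint'
        · rw [integral_one_div_of_pos hl2w0 hlx0]

end GranvilleSoundararajan

end Literature.NumberTheory.LFunctions
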